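import Summits.KontsevichZagierPeriods.Zeta5Search.Certificates.VIML3FinData
import Summits.KontsevichZagierPeriods.Zeta5Search.Certificates.VIML3CertM00
import Summits.KontsevichZagierPeriods.Zeta5Search.Certificates.VIML3CertM01
import Summits.KontsevichZagierPeriods.Zeta5Search.Certificates.VIML3CertM10
import Summits.KontsevichZagierPeriods.Zeta5Search.Certificates.VIML3CertM11
import Summits.KontsevichZagierPeriods.Zeta5Search.Certificates.VIML3CertM20
import Summits.KontsevichZagierPeriods.Zeta5Search.Certificates.VIML3CertM21
import HarnessLib

/-!
# ζ(5) search — brown9 LEVEL 3: coordinate identity (2,1) of the telescoping certificate, BY THE KERNEL (cell `pub-zeta5`, certifier `cert-1`)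

HONEST FRAMING: systematic search; recurrence certificates; no irrationality claim unless certified.

The coefficient of `L(n,x+2)·R(n,x+1)` in the cleared termwise identity
`(x+1) d D D⁺ Σ_i P_i π_i L(n+i,x)R(n+i,x) + (n+4−x) N₄ D Σ M⁺_ab L(n,x+1+a)R(n,x+1+b) + (x+1) N₄ D⁺ Σ M_ab L(n,x+a)R(n,x+b)`
multiplied by `Λ_L Λ_R`, after reduction of every shifted block to the basis by the transfer lemmas (`VIML3Transfer*`): a polynomial
identity in `(n,x)` of bidegree ≤ (198,142) with ≤ 548-bit 1-norm, decided by ONE Kronecker evaluation (`PolyKronecker`). No named facts.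
-/

namespace Summit.KontsevichZagierPeriods.Zeta5Search.Certificates

namespace VIMInner.L3

open PolyReflect
open Lean.Grind.CommRing (Expr)
open Families.CellularVIMRecurrenceLaws (P evalList)

/-- Reflected left-hand side of coordinate identity (2,1). -/
def eFIN21 : Expr :=
  Expr.add (Expr.add (Expr.mul (Expr.mul (Expr.mul (Expr.mul (eXp1) (eDn)) (eDc)) (eDcp)) (Expr.add (Expr.add (Expr.add (Expr.mul (Expr.mul (Expr.mul (Expr.mul (Expr.mul (ePl_1) (ePi_1)) (cofL_1)) (cofR_1)) (cL_1_0_2)) (cR_1_0_1)) (Expr.mul (Expr.mul (Expr.mul (Expr.mul (Expr.mul (ePl_2) (ePi_2)) (cofL_2)) (cofR_2)) (cL_2_0_2)) (cR_2_0_1))) (Expr.mul (Expr.mul (Expr.mul (Expr.mul (Expr.mul (ePl_3) (ePi_3)) (cofL_3)) (cofR_3)) (cL_3_0_2)) (cR_3_0_1))) (Expr.mul (Expr.mul (Expr.mul (Expr.mul (Expr.mul (ePl_4) (ePi_4)) (cofL_4)) (cofR_4)) (cL_4_0_2)) (cR_4_0_1)))) (Expr.mul (Expr.mul (Expr.mul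 (eN4mx) (eN4)) (eDc)) (Expr.add (Expr.add (Expr.add (Expr.mul (Expr.mul ((substs (τ ((0 : ℕ) : ℤ) (1 : ℤ)) eM10)) (eLamL)) (eLamR)) (Expr.mul (Expr.mul (Expr.mul ((substs (τ ((0 : ℕ) : ℤ) (1 : ℤ)) eM11)) (eLamL)) (cofK2)) (cR_0_2_1))) (Expr.mul (Expr.mul (Expr.mul ((substs (τ ((0 : ℕ) : ℤ) (1 : ℤ)) eM20)) (cofK3)) (cL_0_3_2)) (eLamR))) (Expr.mul (Expr.mul (Expr.mul (Expr.mul ((substs (τ ((0 : ℕ) : ℤ) (1 : ℤ)) eM21)) (cofK3)) (cL_0_3_2)) (cofK2)) (cR_0_2_1))))) (Expr.mul (Expr.mul (Expr.mul (Expr.mul (Expr.mul (eXp1) (eN4)) (eDcp)) (eLamL)) (eLamR)) (eM21))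

/-- **Coordinate identity (2,1)** of the level-3 certificate: `peval eFIN21 (V n x) = 0` (kernel, one evaluation). -/
theorem fin21 (n : ℕ) (x : ℚ) : peval eFIN21 (V n x) = 0 :=
  peval_eq_zero_of_kron eFIN21 (by decide +kernel) (by decide +kernel) _ _ _

end VIMInner.L3

end Summit.KontsevichZagierPeriods.Zeta5Search.Certificates
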